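import Mathlib

/-!
# Sketch — first lemmas for the crux-idea cards on stmt-Langlands-13457
(`TwoAdicBianchiProModularity`), ideator 3, round 1.

Both lemmas are pure commutative algebra; they are the two "last steps" of the two lines:

* `factorsThroughOfKerLeNilradical` (card `hida-torsion-weight-ordinary-rt`): an `R^{red} = 𝕋`-level
  statement suffices for a CHARACTERISTIC-ZERO point — if `R ↠ T` has nil kernel then every ring map
  from `R` to a reduced ring (e.g. `ℤ̄₂`, the Artin point `σ : R_S(σ̄) → ℤ̄₂`) factors through `T`.
  This is why the 2-adic pathologies of Taylor–Wiles patching at `p = 2` (Kisin: only `R^{red} = 𝕋`)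
  cost nothing here.
* `annihilator_le_ker_of_nontrivial_baseChange` (card `unconditioned-at-two-artin-fibre`): if the
  `σ`-fibre `κ(σ) ⊗_R M` of an `R`-module `M` (completed homology `H̃₁(U^p)_𝔪`, NOT finitely
  generated over `R`) is non-zero, then `Ann_R M ⊆ ker(R → κ(σ))`, i.e. `σ` is a point of the
  faithful quotient `𝕋 = R / Ann_R M` — no flatness and no `R = 𝕋` needed.
-/

set_option linter.dupNamespace false

namespace Summit.Langlands.Langlands.Cruxes.TwoAdicBianchiProModularity.Ideator3

open scoped TensorProduct

/-- Card A, first lemma: a surjection with nil kernel is as good as an isomorphism for maps to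
reduced rings. -/
theorem factorsThroughOfKerLeNilradical {R T A : Type*} [CommRing R] [CommRing T] [CommRing A]
    [IsReduced A] (f : R →+* T) (hf : Function.Surjective f)
    (hker : RingHom.ker f ≤ nilradical R) (φ : R →+* A) :
    ∃ ψ : T →+* A, ψ.comp f = φ := by
  have hle : RingHom.ker f ≤ RingHom.ker φ := by
    intro x hx
    have hnil : IsNilpotent x := mem_nilradical.mp (hker hx)
    have : IsNilpotent (φ x) := hnil.map φ
    simpa [RingHom.mem_ker] using this.eq_zero
  refine ⟨(RingHom.liftOfRightInverse f (Function.surjInv hf) (Function.rightInverse_surjInv hf))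
    ⟨φ, hle⟩, ?_⟩
  ext x
  simp [RingHom.liftOfRightInverse_comp_apply]

/-- Card B, first lemma: a non-zero fibre at a field-valued point forces the annihilator into the
point's kernel (the module need not be finitely generated). -/
theorem annihilator_le_ker_of_nontrivial_baseChange {R A : Type*} [CommRing R] [Field A]
    [Algebra R A] (M : Type*) [AddCommGroup M] [Module R M]
    (h : Nontrivial (A ⊗[R] M)) :
    Module.annihilator R M ≤ RingHom.ker (algebraMap R A) := by
  intro r hr
  rw [RingHom.mem_ker]
  by_contra hne
  -- `r` kills `M`, hence kills `A ⊗ M`; but it acts on `A ⊗ M` through the unit `algebraMap R A r`.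
  have hzero : ∀ x : A ⊗[R] M, r • x = 0 := by
    intro x
    induction x using TensorProduct.induction_on with
    | zero => simp
    | tmul a m =>
        rw [TensorProduct.smul_tmul', TensorProduct.smul_tmul]
        have : r • m = 0 := Module.mem_annihilator.mp hr m
        simp [this]
    | add x y hx hy => simp [smul_add, hx, hy]
  obtain ⟨x, y, hxy⟩ := h
  apply hxy
  have key : ∀ z : A ⊗[R] M, z = 0 := by
    intro z
    have h1 : (algebraMap R A r) • z = 0 := by rw [algebraMap_smul]; exact hzero z
    calc z = ((algebraMap R A r)⁻¹ * algebraMap R A r) • z := by rw [inv_mul_cancel₀ hne, one_smul]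
      _ = (algebraMap R A r)⁻¹ • ((algebraMap R A r) • z) := by rw [mul_smul]
      _ = 0 := by rw [h1, smul_zero]
  rw [key x, key y]

end Summit.Langlands.Langlands.Cruxes.TwoAdicBianchiProModularity.Ideator3
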